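import Literature.Analysis.FluidPDE.SuitableWeak
import HarnessLib

/-!
# Kwon 2023, Def. 2.4: suitable weak solutions of the drift-perturbed Navier–Stokes system
# (the notion of Kwon's ε-regularity criterion, Thm. 3.1)

Analysis/FluidPDE definition file (a real definition and its first API; no named facts).
H. Kwon, *The role of the pressure in the regularity theory for the Navier–Stokes equations*,
J. Differential Equations 357 (2023) = arXiv:2104.03160, proves his pressure-free ε-regularity theorem (Thm. 1.4, the tree's named fact
`Literature.Analysis.FluidPDE.kwon2023_velocity_epsilon_regularity`,
`PressureFreeEpsilonRegularity.lean`) in two printed steps: Lemma 2.5 (a dissipative solution `u`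
of Navier–Stokes on `Q₂` decomposes on `(−4,0) × B₁` as `u = v + h`, `h` harmonic, `v` a suitable
weak solution of a *perturbed* Navier–Stokes system with small pressure `q` and force `f`) and
**Theorem 3.1**, an ε-regularity criterion for suitable weak solutions of that perturbed system

  `∂ₜv + λ(v·∇)v + (v·∇)h + (h·∇)v + ∇q = Δv + f`, `div v = 0`                    (gen.NS)

(§2 (gen.NS) with `λ ∈ ℝ`; (per.NS) is `λ = 1`), in the sense of his Def. 2.4. This file defines

* `Kwon2023.IsPerturbedSuitableOn O λ h Dh f v q` — **Def. 2.4** as a Lean structure (a real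
  definition, modelled on the accepted `IsSuitableWeakSolutionOn`/`IsDistributionalNSSolutionOn`
  of `SuitableWeak.lean`/`WeakSolution.lean`, to which it reduces for `h = 0`, `f` the force and
  `λ = 1`): PRINTED: "We call `(u,p)` [sic] as a suitable weak solution to generalized
  Navier–Stokes equations (gen.NS) on a domain `𝒪 ⊂ ℝ × ℝ³` for `λ ∈ ℝ`, divergence-free
  `h ∈ L²_t L^∞_x(𝒪)` and divergence-free `f ∈ L¹_t L²_x(𝒪)` if the following holds:
  • `v ∈ L^∞_t L²_x(𝒪)`, `∇v ∈ L²(𝒪)`, and `q ∈ L^{3/2}(𝒪)`. • `(v,q)` solves (gen.NS) in `𝒪` in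
  distribution sense. • `(v,q)` satisfies the local energy inequality
  `(∂ₜ − Δ)(½|v|²) + |∇v|² + div(½|v|²(λv + h)) + div(h ⊗ v)·v + div(qv) − f·v ≤ 0` in
  distribution sense in `𝒪`. Here and in what follows, `div(a ⊗ b)` denotes `∂ⱼ(aᵢbⱼ)`."
  Rendering (time first, `z = (t, x)`): the distributional meaning of the drift terms uses
  `div v = div h = 0`, `λ(v·∇)v + (v·∇)h + (h·∇)v = div(λ v ⊗ v + h ⊗ v + v ⊗ h)`, tested
  `−∫∫ (λ⟪v,(v·∇)ψ⟫ + ⟪h,(v·∇)ψ⟫ + ⟪v,(h·∇)ψ⟫)` (`convect a ψ = (a·∇)ψ`); the term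
  `div(h ⊗ v)·v = ⟪(v·∇)h, v⟫ = ⟪Dh(v), v⟫` of the local energy inequality needs a spatial
  gradient of `h`, carried as the parameter `Dh`, a weak spatial gradient of `h` on `𝒪`
  (`HasWeakSpatialGradientOn`; in Thm. 3.1 `h ∈ L^r_t W^{1,∞}_x`); the local energy inequality
  is tested against nonnegative `φ ∈ C_c^∞(𝒪)` exactly as CKN's (2.5) is in
  `IsSuitableWeakSolutionOn` (for `h = 0`, `λ = 1` it is literally that inequality with `ν = 1`):
  `2∫∫ |∇v|²φ ≤ ∫∫ (|v|²(φₜ + Δφ) + |v|²⟪λv + h, ∇φ⟫ − 2⟪Dh(v), v⟫φ + 2q⟪v, ∇φ⟫ + 2⟪f, v⟫φ)`.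
  The classes are GLOBAL on `𝒪` as printed (`L^∞_t L²_x(𝒪)`, `L²(𝒪)`, `L^{3/2}(𝒪)`,
  `L²_t L^∞_x(𝒪)`, `L¹_t L²_x(𝒪)`), written with the indicator of `𝒪` on the slices.
* `Kwon2023.IsPerturbedSuitableOn.isSuitableWeakSolutionOn_of_drift_eq_zero` — consistency
  with CKN: for `h = 0`, `λ = 1` the notion implies `IsSuitableWeakSolutionOn O 1 f v q`.

The theorem this definition serves, **Thm. 3.1** (NOT vendored in this file — see below),
PRINTED: "For any `r, m ∈ (2, ∞]` with `2/r + 3/m < 2`, there exist `ε₀ = ε₀(r, m) > 0` and a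
universal constant `C > 0` such that if a suitable weak solution `(v, q)` to (per.NS) on `Q₁` for
some `h` and `f` with `div h = div f = 0` satisfies
`‖v‖_{L^r_t L^m_x(Q₁)} + ‖q‖_{L^{r/2}_t L^{m/2}_x(Q₁)} + ‖h‖_{L^r_t W^{1,∞}_x(Q₁)} + ‖f‖_{L^{r/2}_t L^∞_x(Q₁)} ≤ ε₀`,
then we have `‖v‖_{C^α_par(Q_{1/2})} ≤ C` for some `α ∈ (0, 1/2 − 1/r)`" (`Q_ρ = (t₀ − ρ², t₀) × B_ρ(x₀)`
backward cylinders, `C^α_par` the Hölder space for the parabolic distance). In the tree's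
vocabulary, case `r = m = 3` at a centre `z₀`: hypothesis
`Kwon2023.IsPerturbedSuitableOn (parabolicCylinderOpens 1 z₀) 1 h Dh f v q` and
`(∫⁻_{Q₁} ‖v‖ₑ³)^{1/3} + (∫⁻_{Q₁} ‖q‖ₑ^{3/2})^{2/3} + ‖t ↦ ess sup_{B₁}(‖h t‖ + ‖Dh t‖)‖_{L³(t₀−1,t₀)}
 + ‖t ↦ ess sup_{B₁} ‖f t‖‖_{L^{3/2}(t₀−1,t₀)} ≤ ε₀`; conclusion: `∃ α ∈ (0, 1/6)` and a
representative `V` of `v` on `Q_{1/2}(z₀)` with `‖V‖ ≤ C` and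
`‖V z₁ − V z₂‖ ≤ C (‖x₁ − x₂‖ + |t₁ − t₂|^{1/2})^α` there.

Why Thm. 3.1 is not vendored here: its printed proof (§3, pp. 10–15) is Lin's compactness
scheme — the oscillation Lemma 3.3 by contradiction (uniform energy bounds through the iteration
Lemma 3.4 and the interpolation Lemma 3.5, Aubin–Lions compactness, a limiting linear Stokes
system with drift and its parabolic regularity) followed by a Campanato iteration; none of this
parabolic machinery for the PERTURBED system is in the tree (cf. the module docstring of
`JiaSverak2014LocalRegularity.lean`: "the tree has none of the parabolic regularity theory of §2
(ε-regularity for the perturbed system (2.1), Campanato iteration)"). It is the ε-regularity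
input of the discharge of `kwon2023_velocity_epsilon_regularity` (Thm. 1.4 = Lemma 2.5 +
Thm. 3.1, §4), whose Lemma 2.5 half is being proved in the tree (`KwonHarmonicPart.lean`,
`KwonTestField.lean`, `KwonLocalLerayDuality.lean`, …) with THIS notion as its target; under
D-0026 a proving seat does not state it as a new named fact, so only the definition is landed.

## Mathlib / tree search

`lean search 'Perturbed|perturbed_epsilon|drift.*Suitable|IsSuitable.*Drift'`: the tree has the
classical drift system of Leray's scheme (`ClassicalDriftSuitable.lean`, `DriftSuitableStability.lean`:
`∂ₜu + (b·∇)u = νΔu − ∇p`, no `(u·∇)b` term, no force, classical/limit statements only) and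
Jia–Šverák's perturbed local energy inequality for `v = u − a` with `a` SMOOTH in space–time
(`JiaSverak2014PerturbedLocalEnergy.lean`), but no notion of suitable weak solution of (gen.NS)
and no ε-regularity criterion for it (2026-08-17).

## References

* H. Kwon, *The role of the pressure in the regularity theory for the Navier–Stokes equations*,
  J. Differential Equations 357 (2023) 1–31 = arXiv:2104.03160: Def. 2.4 (arXiv p. 7), Thm. 3.1
  and Remark 3.2 (p. 10), Lemma 3.3–3.5, §4. [Kwon2023RolePressure]
* L. Caffarelli, R. Kohn, L. Nirenberg, CPAM 35 (1982), §2 (2.1)–(2.5) (suitable weak solutions;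
  the case `h = 0`). [CaffarelliKohnNirenberg1982]
* H. Jia, V. Šverák, Invent. Math. 196 (2014), §2 Thm. 2.2 (ε-regularity for the perturbed
  system with `a ∈ L^m`, `m > 5`). [JiaSverak2014]
-/

noncomputable section

open MeasureTheory Set Function Filter TopologicalSpace Metric
open scoped ENNReal NNReal InnerProductSpace RealInnerProductSpace Laplacian

namespace Literature.Analysis.FluidPDE

section Definition

variable {E : Type*} [NormedAddCommGroup E] [InnerProductSpace ℝ E] [FiniteDimensional ℝ E]
  [MeasurableSpace E] [BorelSpace E]

/-- **Kwon 2023, Def. 2.4 — suitable weak solutions of the perturbed ("generalized")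
Navier–Stokes system** `∂ₜv + λ(v·∇)v + (v·∇)h + (h·∇)v + ∇q = Δv + f`, `div v = 0` on an open
space–time region `O ⊆ ℝ × E`, for a parameter `λ ∈ ℝ`, a divergence-free drift
`h ∈ L²_t L^∞_x(O)` with weak spatial gradient `Dh`, and a divergence-free force
`f ∈ L¹_t L²_x(O)`: `v ∈ L^∞_t L²_x(O)`, `∇v ∈ L²(O)`, `q ∈ L^{3/2}(O)`; `(v, q)` solves the
system in the sense of distributions on `O`; and the local energy inequality
`(∂ₜ − Δ)(½|v|²) + |∇v|² + div(½|v|²(λv + h)) + div(h ⊗ v)·v + div(qv) − f·v ≤ 0` holds in the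
sense of distributions on `O` (`div(a ⊗ b) = ∂ⱼ(aᵢbⱼ)`, so `div(h ⊗ v)·v = ⟪(v·∇)h, v⟫`), i.e.
for every nonnegative `φ ∈ C_c^∞(O)`
`2∫∫ |∇v|²φ ≤ ∫∫ (|v|²(φₜ + Δφ) + |v|²⟪λv + h, ∇φ⟫ − 2⟪Dh(v), v⟫φ + 2q⟪v, ∇φ⟫ + 2⟪f, v⟫φ)`.
For `h = 0`, `λ = 1` this is `IsSuitableWeakSolutionOn O 1 f v q` (CKN (2.1)–(2.5) with
`ν = 1`), with the classes global on `O` as printed. See the module docstring for the verbatim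
source and the rendering. [cite: Kwon2023RolePressure, Def. 2.4] -/
structure Kwon2023.IsPerturbedSuitableOn (O : Opens (ℝ × E)) (lam : ℝ) (h : ℝ → E → E)
    (Dh : ℝ → E → E →L[ℝ] E) (f v : ℝ → E → E) (q : ℝ → E → ℝ) : Prop where
  /-- `v` is locally integrable on `O`. -/
  locallyIntegrableOn : LocallyIntegrableOn (uncurry v) (O : Set (ℝ × E)) volume
  /-- `|v|²` is locally integrable on `O`. -/
  locallyIntegrableOn_sq :
    LocallyIntegrableOn (fun z => ‖uncurry v z‖ ^ 2) (O : Set (ℝ × E)) volume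
  /-- `v ∈ L^∞_t L²_x(O)`: the spatial `L²` norms of the slices of `v` over the sections of
  `O` are essentially bounded in time. -/
  energyClass : ∃ C : ℝ≥0, ∀ᵐ t : ℝ,
    ∫⁻ x, (O : Set (ℝ × E)).indicator (fun z : ℝ × E => ‖v z.1 z.2‖ₑ ^ 2) (t, x) ≤ C
  /-- `q` is a.e.-strongly measurable on `O`. -/
  aestronglyMeasurable_pressure :
    AEStronglyMeasurable (uncurry q) (volume.restrict (O : Set (ℝ × E)))
  /-- `q` is locally integrable on `O` (implied by `q ∈ L^{3/2}(O)`; recorded as in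
  `IsDistributionalNSSolutionOn`, so that the distributional identity is literally meaningful). -/
  locallyIntegrableOn_pressure : LocallyIntegrableOn (uncurry q) (O : Set (ℝ × E)) volume
  /-- `q ∈ L^{3/2}(O)`. -/
  pressure : ∫⁻ z in (O : Set (ℝ × E)), ‖q z.1 z.2‖ₑ ^ (3 / 2 : ℝ) < ∞
  /-- `Dh` is a weak spatial gradient of the drift `h` on `O` (`h`, `Dh` locally integrable). -/
  drift : HasWeakSpatialGradientOn O h Dh
  /-- `h ∈ L²_t L^∞_x(O)`. -/
  driftClass : ∫⁻ t, eLpNorm (fun x => (O : Set (ℝ × E)).indicator (uncurry h) (t, x)) ∞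
    (volume : Measure E) ^ (2 : ℕ) < ∞
  /-- `div h = 0` weakly on `O`. -/
  drift_divFree : ∀ θ : ℝ → E → ℝ, IsSpaceTimeTestOn O θ →
    ∫ z in (O : Set (ℝ × E)), ⟪h z.1 z.2, gradient (θ z.1) z.2⟫ = 0
  /-- `f` is a.e.-strongly measurable on `O`. -/
  aestronglyMeasurable_force :
    AEStronglyMeasurable (uncurry f) (volume.restrict (O : Set (ℝ × E)))
  /-- `f ∈ L¹_t L²_x(O)`. -/
  forceClass : ∫⁻ t, (∫⁻ x, (O : Set (ℝ × E)).indicator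
    (fun z : ℝ × E => ‖f z.1 z.2‖ₑ ^ 2) (t, x)) ^ (1 / 2 : ℝ) < ∞
  /-- `div f = 0` weakly on `O`. -/
  force_divFree : ∀ θ : ℝ → E → ℝ, IsSpaceTimeTestOn O θ →
    ∫ z in (O : Set (ℝ × E)), ⟪f z.1 z.2, gradient (θ z.1) z.2⟫ = 0
  /-- `div v = 0` weakly on `O`. -/
  divFree : ∀ θ : ℝ → E → ℝ, IsSpaceTimeTestOn O θ →
    ∫ z in (O : Set (ℝ × E)), ⟪v z.1 z.2, gradient (θ z.1) z.2⟫ = 0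
  /-- The momentum equation in the sense of distributions on `O`: for every vector test field
  `ψ ∈ C_c^∞(O; E)`,
  `∫∫_O (⟪v, ∂ₜψ⟫ + λ⟪v, (v·∇)ψ⟫ + ⟪h, (v·∇)ψ⟫ + ⟪v, (h·∇)ψ⟫ + ⟪v, Δψ⟫ + q div ψ + ⟪f, ψ⟫) = 0`. -/
  momentum : ∀ ψ : ℝ → E → E, IsSpaceTimeTestOn O ψ →
    ∫ z in (O : Set (ℝ × E)), (⟪v z.1 z.2, timeDeriv ψ z.1 z.2⟫ +
      lam * ⟪v z.1 z.2, convect (v z.1) (ψ z.1) z.2⟫ +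
      ⟪h z.1 z.2, convect (v z.1) (ψ z.1) z.2⟫ + ⟪v z.1 z.2, convect (h z.1) (ψ z.1) z.2⟫ +
      ⟪v z.1 z.2, Δ (ψ z.1) z.2⟫ + q z.1 z.2 * VectorCalculus.divergence (ψ z.1) z.2 +
      ⟪f z.1 z.2, ψ z.1 z.2⟫) = 0
  /-- `∇v ∈ L²(O)` and the local energy inequality: there is a weak spatial gradient `G` of `v`
  on `O`, square integrable over `O`, such that for every nonnegative `φ ∈ C_c^∞(O)`
  `2∫∫ |G|²φ ≤ ∫∫ (|v|²(φₜ + Δφ) + |v|²⟪λv + h, ∇φ⟫ − 2⟪Dh(v), v⟫φ + 2q⟪v, ∇φ⟫ + 2⟪f, v⟫φ)`. -/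
  localEnergy : ∃ G : ℝ → E → E →L[ℝ] E, HasWeakSpatialGradientOn O v G ∧
    (∫⁻ z in (O : Set (ℝ × E)), ENNReal.ofReal (frobeniusNormSq (G z.1 z.2)) < ∞) ∧
    ∀ φ : ℝ → E → ℝ, IsSpaceTimeTestOn O φ → (∀ t x, 0 ≤ φ t x) →
      2 * ∫ t, ∫ x, frobeniusNormSq (G t x) * φ t x ≤
        ∫ t, ∫ x, (‖v t x‖ ^ 2 * (timeDeriv φ t x + Δ (φ t) x) +
          ‖v t x‖ ^ 2 * ⟪lam • v t x + h t x, gradient (φ t) x⟫ -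
          2 * ⟪Dh t x (v t x), v t x⟫ * φ t x +
          2 * q t x * ⟪v t x, gradient (φ t) x⟫ + 2 * ⟪f t x, v t x⟫ * φ t x)

namespace Kwon2023.IsPerturbedSuitableOn

variable {O : Opens (ℝ × E)} {lam : ℝ} {h f v : ℝ → E → E} {Dh : ℝ → E → E →L[ℝ] E}
  {q : ℝ → E → ℝ}

/-- The weak spatial gradient class: some weak spatial gradient of `v` on `O` is square
integrable over `O`. [cite: Kwon2023RolePressure, Def. 2.4] -/
theorem exists_weakGradient_sq_integrable (hs : IsPerturbedSuitableOn O lam h Dh f v q) :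
    ∃ G : ℝ → E → E →L[ℝ] E, HasWeakSpatialGradientOn O v G ∧
      ∫⁻ z in (O : Set (ℝ × E)), ENNReal.ofReal (frobeniusNormSq (G z.1 z.2)) < ∞ := by
  obtain ⟨G, hG, hG2, -⟩ := hs.localEnergy
  exact ⟨G, hG, hG2⟩

/-- **Consistency with Caffarelli–Kohn–Nirenberg**: for `h = 0` (and `Dh = 0`), `λ = 1`, a
suitable weak solution of the perturbed system in the sense of Kwon's Def. 2.4 on `O` is a
suitable weak solution of the forced Navier–Stokes system with viscosity `1` on `O` in the sense
of CKN (2.1)–(2.5) (`IsSuitableWeakSolutionOn O 1 f v q`): the drift terms vanish, the local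
energy inequality becomes (2.5), and the global classes on `O` give the local ones.
[cite: Kwon2023RolePressure, Def. 2.4] -/
theorem isSuitableWeakSolutionOn_of_drift_eq_zero
    (hs : IsPerturbedSuitableOn O 1 (0 : ℝ → E → E) (0 : ℝ → E → E →L[ℝ] E) f v q) :
    IsSuitableWeakSolutionOn O 1 f v q where
  distributional := by
    refine ⟨hs.locallyIntegrableOn, hs.locallyIntegrableOn_sq, hs.locallyIntegrableOn_pressure,
      hs.divFree, fun ψ hψ => ?_⟩
    rw [← hs.momentum ψ hψ]
    refine setIntegral_congr_fun O.isOpen.measurableSet fun z _ => ?_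
    simp only [Pi.zero_apply, inner_zero_left, one_mul, add_zero, convect, map_zero,
      inner_zero_right]
  energyClass K hK _ := by
    obtain ⟨C, hC⟩ := hs.energyClass
    refine ⟨C, hC.mono fun t ht => le_trans (lintegral_mono fun x => ?_) ht⟩
    exact indicator_le_indicator_of_subset hK (fun _ => bot_le) _
  pressure K hK _ := lt_of_le_of_lt (lintegral_mono_set hK) hs.pressure
  localEnergy := by
    obtain ⟨G, hG, hG2, hlei⟩ := hs.localEnergy
    refine ⟨G, hG, fun K hK _ => lt_of_le_of_lt (lintegral_mono_set hK) hG2, fun φ hφ hφ0 => ?_⟩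
    have h1 := hlei φ hφ hφ0
    rw [mul_one]
    refine h1.trans_eq (integral_congr_ae (Eventually.of_forall fun t => ?_))
    refine integral_congr_ae (Eventually.of_forall fun x => ?_)
    simp only [Pi.zero_apply, one_smul, add_zero, _root_.zero_apply,
      inner_zero_left, mul_zero, zero_mul, sub_zero, one_mul]
    ring

end Kwon2023.IsPerturbedSuitableOn

end Definition


end Literature.Analysis.FluidPDE

end
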